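import Literature.NumberTheory.LFunctions.WeilMellinInversion
import Literature.NumberTheory.LFunctions.WeilLineZerosDensityLemmas
import HarnessLib

/-!
# Zeros of the Weil transform of a short window cannot have uniform density above `b/π`

Let `W : ℝ → ℂ` be continuous with support in `[-b, b]` and let
`Ŵ(s) = ∫ W(t) e^{(s-1/2)t} dt` (`Literature.NumberTheory.LFunctions.weilMellin`) be its
Weil–Mellin transform: an entire function with `|Ŵ(s)| ≤ e^{b |Re s - 1/2|} ∫ |W|`
(exponential type `b` off the critical line, bounded on it:
`norm_weilMellin_le_exp_mul_integral_norm`). If `Ŵ` vanishes at the points `1/2 + iμ_n`,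
`n ∈ ℤ`, of a real sequence of **uniform density `d`** — `μ` injective with
`|μ_n - n/d| ≤ M` — and `b < π d`, then `Ŵ` vanishes on the whole critical line
(`weilMellin_line_eq_zero_of_zeros_uniformDensity`); in particular `Ŵ(1/2) = ∫ W = 0`
(`weilMellin_half_eq_zero_of_zeros_uniformDensity`).

This is the uniqueness half of the classical density theorems for zeros of functions of
exponential type (Duffin–Schaeffer 1952 §1: "an entire function of exponential type `γ < π`
is completely determined by its values at any sequence of uniform density 1"; Paley–Wiener,
Levinson; Young 2001 Ch. 3), in the generality needed for Beurling's compactness proof of the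
Duffin–Schaeffer sampling theorem. The proof is Jensen's formula (Mathlib
`AnalyticOnNhd.circleAverage_log_norm`) on circles `|s - 1/2| = R`: the mean of `log |Ŵ|` is
at most `log K + (2b/π) R`, whereas the zeros `1/2 + iμ_n`, `|μ_n| ≤ R`, contribute at least
`Σ log(R/|μ_n|) ≥ 2d(q + h) R - C` for a suitable level-set parameter `h > 0`, `q = b/(πd) < 1`
(`WeilLineZerosDensityLemmas.lean`); `R → ∞` gives the contradiction.
Everything is proved; no definitions, no named facts.
-/

noncomputable section

open Complex Set MeasureTheory Filter Metric
open scoped Real Topology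

namespace Literature.NumberTheory.LFunctions

/-! ### Growth of the transform of a short window -/

/-- For `W` continuous with `tsupport W ⊆ [-b, b]` and `A ≥ 0`:
`∫ ‖W‖ e^{A|t|} ≤ e^{A b} ∫ ‖W‖`. [folklore] -/
theorem weilL1W_le_exp_mul_integral_norm {W : ℝ → ℂ} (hW : Continuous W)
    (hWs : HasCompactSupport W) {b A : ℝ} (hsupp : tsupport W ⊆ Icc (-b) b) (hA : 0 ≤ A) :
    weilL1W A W ≤ Real.exp (A * b) * ∫ t, ‖W t‖ := by
  unfold weilL1W
  rw [← integral_const_mul]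
  refine integral_mono_of_nonneg (Eventually.of_forall fun t => by positivity)
    ((hW.norm.const_mul _).integrable_of_hasCompactSupport (hWs.norm.mul_left)) ?_
  refine Eventually.of_forall fun t => ?_
  by_cases ht : W t = 0
  · simp [ht]
  · have hmem : t ∈ Icc (-b) b := hsupp (subset_tsupport _ (Function.mem_support.2 ht))
    have habs : |t| ≤ b := abs_le.2 ⟨hmem.1, hmem.2⟩
    show ‖W t‖ * Real.exp (A * |t|) ≤ Real.exp (A * b) * ‖W t‖
    rw [mul_comm (Real.exp (A * b))]
    gcongr

/-- **Exponential type off the line.** For `W` continuous with `tsupport W ⊆ [-b, b]`, `b ≥ 0`: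
`‖Ŵ(s)‖ ≤ e^{b |Re s - 1/2|} ∫ ‖W‖`. [folklore] -/
theorem norm_weilMellin_le_exp_mul_integral_norm {W : ℝ → ℂ} (hW : Continuous W)
    (hWs : HasCompactSupport W) {b : ℝ} (hsupp : tsupport W ⊆ Icc (-b) b) (s : ℂ) :
    ‖weilMellin W s‖ ≤ Real.exp (b * |s.re - 1 / 2|) * ∫ t, ‖W t‖ := by
  have h := norm_weilMellin_le_weilL1W hW hWs (A := |s.re - 1 / 2|) (s := s) le_rfl
  refine h.trans ?_
  rw [mul_comm b]
  exact weilL1W_le_exp_mul_integral_norm hW hWs hsupp (abs_nonneg _)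

/-! ### The density theorem -/

/-- **Zeros of uniform density `d > b/π` force `Ŵ(1/2) = 0`.** Let `W` be continuous with
`tsupport W ⊆ [-b, b]`, `b < π d`, and let `μ : ℤ → ℝ` be injective with `|μ_n - n/d| ≤ M`. If
`Ŵ(1/2 + iμ_n) = 0` for every `n`, then `Ŵ(1/2) = 0` (Jensen's formula on `|s - 1/2| = R`,
`R → ∞`: the zeros contribute `≥ 2d(1 - o(1))R`, the growth only `(2b/π)R + O(1)`).
(Duffin–Schaeffer 1952 §1; Young 2001 Ch. 3.) [cite: DuffinSchaeffer1952, §1] -/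
theorem weilMellin_half_eq_zero_of_zeros_uniformDensity {W : ℝ → ℂ} (hW : Continuous W)
    (hWs : HasCompactSupport W) {b d M : ℝ} (hd : 0 < d) (hbd : b < π * d)
    (hsupp : tsupport W ⊆ Icc (-b) b) {μ : ℤ → ℝ} (hinj : Function.Injective μ)
    (hμ : ∀ n, |μ n - n / d| ≤ M) (hzero : ∀ n, weilMellin W (1 / 2 + μ n * I) = 0) :
    weilMellin W (1 / 2) = 0 := by
  by_contra h0
  have hπ : 0 < π := Real.pi_pos
  have hM : 0 ≤ M := (abs_nonneg _).trans (by simpa using hμ 0)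
  -- `b ≥ 0`, for otherwise `W = 0`
  have hb : 0 ≤ b := by
    by_contra hb
    push Not at hb
    apply h0
    have hW0 : W = 0 := by
      funext t
      by_contra ht
      have hmem := hsupp (subset_tsupport _ (Function.mem_support.2 ht))
      rw [mem_Icc] at hmem
      linarith [hmem.1, hmem.2]
    simp [hW0, weilMellin]
  -- the entire function and its growth
  set F : ℂ → ℂ := weilMellin W with hFdef
  set c : ℂ := ((1 / 2 : ℝ) : ℂ) with hc
  have hc' : c = 1 / 2 := by rw [hc]; push_cast; ring
  have h0c : F c ≠ 0 := by rwa [hc']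
  have hF : AnalyticOnNhd ℂ F univ := analyticOnNhd_weilMellin hW hWs univ
  set K : ℝ := (∫ t, ‖W t‖) + 1 with hK
  have hN0 : 0 ≤ ∫ t, ‖W t‖ := integral_nonneg fun _ => norm_nonneg _
  have hK1 : 1 ≤ K := by rw [hK]; linarith
  have hK0 : 0 < K := by linarith
  have hgrowth : ∀ s : ℂ, ‖F s‖ ≤ K * Real.exp (b * |s.re - 1 / 2|) := by
    intro s
    have h1 := norm_weilMellin_le_exp_mul_integral_norm hW hWs hsupp s
    have h2 : (∫ t, ‖W t‖) ≤ K := by rw [hK]; linarith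
    calc ‖F s‖ ≤ Real.exp (b * |s.re - 1 / 2|) * ∫ t, ‖W t‖ := h1
      _ ≤ Real.exp (b * |s.re - 1 / 2|) * K :=
          mul_le_mul_of_nonneg_left h2 (Real.exp_pos _).le
      _ = K * Real.exp (b * |s.re - 1 / 2|) := mul_comm _ _
  have hFc_le : ‖F c‖ ≤ K := by
    have := hgrowth c
    rw [hc'] at this ⊢
    simpa using this
  -- every `μ n` is nonzero
  have hμ0 : ∀ n, μ n ≠ 0 := by
    intro n h
    apply h0
    have h1 := hzero n
    rw [h] at h1
    simpa using h1
  -- parameters of the level-set count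
  set q : ℝ := b / (π * d) with hq
  have hq0 : 0 ≤ q := div_nonneg hb (by positivity)
  have hq1 : q < 1 := by rw [hq, div_lt_one (by positivity)]; exact hbd
  have hbq : 2 * b / π = 2 * d * q := by rw [hq]; field_simp
  obtain ⟨h, J, hh0, hσq⟩ := exists_levelSet_parameters hq0 hq1
  set σ : ℝ := h * ∑ j ∈ Finset.range J, Real.exp (-h) ^ (j + 1) with hσ
  -- the radius
  set C₁ : ℝ := Real.log K - Real.log ‖F c‖ with hC₁
  have hC₁0 : 0 ≤ C₁ := by
    rw [hC₁, sub_nonneg]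
    exact Real.log_le_log (norm_pos_iff.2 h0c) hFc_le
  set C₂ : ℝ := J * h * (2 * d * M + 1) with hC₂
  have hC₂0 : 0 ≤ C₂ := by positivity
  set R : ℝ := (C₁ + C₂) / (2 * d * h) + 1 with hR
  have hpos : 0 < 2 * d * h := by positivity
  have hR0 : 0 < R := by
    have : 0 ≤ (C₁ + C₂) / (2 * d * h) := by positivity
    rw [hR]; linarith
  have hRbig : C₁ + C₂ < 2 * d * h * R := by
    rw [hR, mul_add, mul_div_cancel₀ _ hpos.ne']
    linarith
  -- Jensen's formula on `|s - 1/2| = R`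
  have hFball : AnalyticOnNhd ℂ F (closedBall c |R|) := hF.mono (subset_univ _)
  have jensen := hFball.circleAverage_log_norm hR0.ne' h0c
  -- upper bound for the circle average
  have hupper : Real.circleAverage (fun z => Real.log ‖F z‖) c R ≤
      Real.log K + 2 * b * R / π := by
    refine le_trans ?_ (circleAverage_log_add_mul_abs_re_le (K := K) (b := b) hR0.le)
    refine Real.circleAverage_mono ?_ ?_ fun z _ => ?_
    · exact (hF.mono (subset_univ _)).meromorphicOn.circleIntegrable_log_norm
    · exact (Continuous.continuousOn (by fun_prop)).circleIntegrable'
    · by_cases hz : F z = 0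
      · rw [hz, norm_zero, Real.log_zero]
        have := Real.log_nonneg hK1
        positivity
      · rw [Real.log_le_iff_le_exp (norm_pos_iff.2 hz), Real.exp_add, Real.exp_log hK0]
        exact hgrowth z
  -- lower bound from the zeros `1/2 + iμ_n`, `|μ_n| ≤ R`, and the level-set count
  have hlower := sum_log_div_le_jensen_sum hF h0c hinj hzero hR0
    ((Finset.Icc (-(⌈d * (R + M)⌉₊ : ℤ)) ⌈d * (R + M)⌉₊).filter fun n => |μ n| ≤ R)
    (fun n hn => (Finset.mem_filter.1 hn).2)
  have hcount := levelSet_count_le_sum_log hd hM hμ hμ0 hR0 hh0 J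
  -- combine
  have key : 2 * d * R * σ - C₂ ≤ C₁ + 2 * b * R / π := by
    have := hcount.trans hlower
    rw [jensen] at hupper
    rw [hσ, hC₂, hC₁]
    linarith
  have e : 2 * b * R / π = 2 * d * q * R := by
    rw [show 2 * b * R / π = 2 * b / π * R by ring, hbq]
  rw [e] at key
  have key' : 2 * d * h * R ≤ C₁ + C₂ := by
    have h1 : h ≤ σ - q := by rw [hσ]; linarith
    have hdR : 0 ≤ 2 * d * R := by positivity
    have h2 : 2 * d * R * h ≤ 2 * d * R * (σ - q) := mul_le_mul_of_nonneg_left h1 hdR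
    linarith
  linarith

/-- **Zeros of uniform density `d > b/π` force `Ŵ ≡ 0` on the critical line** (the same,
after a modulation `W(t) e^{ixt}` moving `1/2 + ix` to `1/2`). [cite: DuffinSchaeffer1952, §1] -/
theorem weilMellin_line_eq_zero_of_zeros_uniformDensity {W : ℝ → ℂ} (hW : Continuous W)
    (hWs : HasCompactSupport W) {b d M : ℝ} (hd : 0 < d) (hbd : b < π * d)
    (hsupp : tsupport W ⊆ Icc (-b) b) {μ : ℤ → ℝ} (hinj : Function.Injective μ)
    (hμ : ∀ n, |μ n - n / d| ≤ M) (hzero : ∀ n, weilMellin W (1 / 2 + μ n * I) = 0) (x : ℝ) :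
    weilMellin W (1 / 2 + x * I) = 0 := by
  -- modulate: `V(t) = W(t) e^{ixt}`, `V̂(s) = Ŵ(s + ix)`; shift the sequence by `⌊x d⌋`
  set V : ℝ → ℂ := fun t => W t * cexp ((x * t : ℝ) * I) with hV
  have hVc : Continuous V := by rw [hV]; fun_prop
  have hVs : HasCompactSupport V := hWs.mul_right
  have hVsupp : tsupport V ⊆ Icc (-b) b := (tsupport_mul_subset_left (f := W)).trans hsupp
  have hVM : ∀ s : ℂ, weilMellin V s = weilMellin W (s + x * I) := by
    intro s
    unfold weilMellin
    congr 1 with t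
    simp only [hV]
    rw [mul_assoc, ← Complex.exp_add]
    congr 2
    push_cast
    ring
  set m : ℤ := ⌊x * d⌋ with hm
  set ν : ℤ → ℝ := fun n => μ (n + m) - x with hν
  have hνinj : Function.Injective ν := by
    intro i j h
    have : μ (i + m) = μ (j + m) := by simpa [hν] using h
    exact add_right_cancel (hinj this)
  have hνM : ∀ n, |ν n - n / d| ≤ M + 1 / d := by
    intro n
    have h1 := hμ (n + m)
    have h2 : |(m : ℝ) / d - x| ≤ 1 / d := by
      have hf1 : (m : ℝ) ≤ x * d := Int.floor_le _
      have hf2 : x * d < m + 1 := Int.lt_floor_add_one _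
      have e : (m : ℝ) / d - x = (m - x * d) / d := by field_simp
      rw [e, abs_div, abs_of_pos hd, div_le_div_iff_of_pos_right hd, abs_le]
      constructor <;> linarith
    calc |ν n - n / d| = |(μ (n + m) - (n + m : ℤ) / d) + ((m : ℝ) / d - x)| := by
          simp only [hν]; push_cast; ring_nf
      _ ≤ |μ (n + m) - (n + m : ℤ) / d| + |(m : ℝ) / d - x| := abs_add_le _ _
      _ ≤ M + 1 / d := add_le_add h1 h2
  have hνzero : ∀ n, weilMellin V (1 / 2 + ν n * I) = 0 := by
    intro n
    rw [hVM]
    have e : (1 / 2 : ℂ) + (ν n : ℂ) * I + x * I = 1 / 2 + (μ (n + m) : ℂ) * I := by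
      simp only [hν]; push_cast; ring
    rw [e]
    exact hzero (n + m)
  have h := weilMellin_half_eq_zero_of_zeros_uniformDensity hVc hVs hd hbd hVsupp hνinj hνM hνzero
  rw [hVM] at h
  simpa using h

end Literature.NumberTheory.LFunctions

end
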